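import Literature.NumberTheory.Automorphic.UnitaryTwoTreeActionDescent        -- ★ B-p08 (g28) (W1c)-B: `rhoVertexAct`, `_eq_glVertexAct`, `_mul`, unitary lifts
import HarnessLib

/-!
# Unitary lifts of torus elements and the SHELL DECOMPOSITION of the fixed vertices under `U(Φ₂)(E)`: the `hshell` binder of the orbital-integral unfolding on the tree,
# transported from `GL₂(F)` to `U(Φ₂)(E)` through `ρ` (Labesse–Langlands 1979 §2 p. 8; Serre, *Trees* II.1.3)

Topic `NumberTheory/Automorphic`; namespace `Literature.NumberTheory.Automorphic.UnitaryGroup` (+ two lemmas in `…HermitianLatticeTree`).  THEOREMS ONLY (no definition, no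
instance, no notation, no named fact, no `sorry`); kernel lane.  Cell `pub/hodgecm-mathlib` (D-0151), crux H413 = `stmt-HodgeConjecture-24833`; road «W′» = «R1LL-WILD»
(architect A-p16 (g28), RULING A-37 (Ψ1) «unfolding into `T̃`-shells on `U_w`»: B-p14 (g33) first, B-p08 (g28) second — this file is the ρ-SIDE PIN `hshell` ∕ `r_m` that
B-p14's ★ `integral_conj_eq_smul_sum_shells_onePlace` (p843981) leaves as binders).  GENERIC in the sense of ★ (W1c)-B (`ι : F →+* E`, `σ`, `α`, the descent property `hρ` a
hypothesis); the torus is LL's elliptic torus `t = (c′, e′v₀; e′, c′ + e′u₀)` of an ABSTRACT quadratic datum `(τ_E; u₀, v₀)` with `τ_E² = ι(u₀) τ_E + ι(v₀)`,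
`σ τ_E = ι(u₀) − τ_E` (census W′-v1 (I5); at a ramified CM place `τ_E = ϖ_E`, A-37 FLAG 1).  HONEST LABEL: HC_CM is proved only modulo the cell's 2 remaining named inputs
(hLiu418, h413) until rung 0 closes; nothing printed is asserted here.

THE MATHEMATICS.  §0 (tree side) two elements whose images of a lattice differ by a power of `ϖ` act alike (`glVertexAct_eq_of_mapGL_eq_scaleLattice`).  §1 A torus
element `t ∈ GL₂(F)` of the above shape has `det t = N(z)`, `z = ι(c′) + ι(e′) τ_E` (`σ(z) z = ι(det t)`), hence a UNITARY LIFT `t̃ ∈ U(Φ₂)` with descent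
`diag(1,α) t̃ diag(1,α)⁻¹ = z⁻¹ · ι(t)` (★ `exists_mem_unitaryGroupOfForm_conj_eq_smul_map`); if `t` commutes with the descent `γ` of `u ∈ U`, then `t̃` commutes with `u`
(conjugation by `diag(1,α)` is injective) — `exists_comm_lift_of_torus`.  §2 Hence the GL₂(F)-level SHELL DECOMPOSITION of A-p17 (g23) ★ `exists_torus_glVertexAct_shellRep_eq`
(every vertex is `(t · r_m) · v₀`, `t` in the torus, `m = d x`) lifts VERBATIM to `U(Φ₂)`: for unitary `r̃_m` with `ρ(r̃_m) · v₀ = r_m · v₀`,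
**`∀ x, ∃ t̃ ∈ U, t̃ u = u t̃ ∧ ρ(t̃ · r̃_{d x}) · v₀ = x`** (`exists_comm_rhoVertexAct_mul_eq`) — the `hshell` binder of ★ p843981 ∕ p843957 at `act := ρ`.  §3 The unitary shell
representatives: for `ũ_η = diag(η, (ση)⁻¹) ∈ U` (`η` with `ι(c) = η σ(η)`, `|c| = |ϖ|`), **`ρ(ũ_η⁻¹ ^ m) · v₀ = diag(1, ϖ^m) · v₀`** (`rhoVertexAct_inv_pow_root_eq`).

## References
* [LabesseLanglands1979] J.-P. Labesse, R. P. Langlands, *L-indistinguishability for SL(2)*, Canad. J. Math. 31 (1979), §2 p. 8 (`T(F)∖G(F)∕G(𝒪_F)`, representatives `diag(1, ϖ^m)`).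
* [Serre1980Trees] J.-P. Serre, *Trees* (1980), Ch. II §1.3.
* [Rogawski1990] J. D. Rogawski, *Automorphic Representations of Unitary Groups in Three Variables* (1990), §3.6 p. 31, §4.9 p. 54.
-/

set_option autoImplicit false

noncomputable section

open scoped ValuativeRel Matrix MatrixGroups
open Matrix ValuativeRel

/-! ## §0 Tree side: images differing by a power of `ϖ` give the same vertex -/

namespace Literature.NumberTheory.Automorphic.HermitianLatticeTree

variable {F : Type*} [Field F] [ValuativeRel F] {ϖ : F} (hϖ : IsUniformizingElement ϖ) [IsDiscreteValuationRing 𝒪[F]]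

include hϖ in
/-- If `g M = ϖ^j · g′ M` as lattices, then `g · M = g′ · M` as vertices (the special representative of a homothety class is unique). [cite: Serre1980Trees, Ch. II §1.1] -/
theorem glVertexAct_eq_of_mapGL_eq_scaleLattice (g g' : GL (Fin 2) F)
    (M : {M : Submodule 𝒪[F] (Fin 2 → F) // IsSpecialLattice (RingHom.id F) ϖ !![(0 : F), 1; -1, 0] M}) {j : ℤ}
    (h : mapGL g M.1 = scaleLattice (ϖ ^ j) (mapGL g' M.1)) : glVertexAct hϖ g M = glVertexAct hϖ g' M := by
  obtain ⟨k', hk'⟩ := (glVertexAct_eq_iff hϖ g' M (glVertexAct hϖ g' M)).1 rfl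
  refine (glVertexAct_eq_iff hϖ g M _).2 ⟨k' - j, ?_⟩
  rw [hk', h, scaleLattice_scaleLattice, ← zpow_add₀ hϖ.ne_zero, sub_add_cancel]

include hϖ in
/-- `diag(c⁻¹, 1)^m · 𝒪² = diag(1, ϖ^m) · 𝒪²` as VERTICES when `|c| = |ϖ|` (`diag(c^{−m},1) = c^{−m}·diag(1, c^m)` and `c∕ϖ` is a unit). [cite: LabesseLanglands1979, §2 p. 8] -/
theorem glVertexAct_diagonal_inv_pow_root_eq {c : F} (hc : valuation F c = valuation F ϖ) {gc r : GL (Fin 2) F} {m : ℕ}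
    (hgc : (gc : Matrix (Fin 2) (Fin 2) F) = Matrix.diagonal ![c⁻¹, 1]) (hr : (r : Matrix (Fin 2) (Fin 2) F) = Matrix.diagonal ![1, ϖ ^ m])
    (v₀ : {M : Submodule 𝒪[F] (Fin 2 → F) // IsSpecialLattice (RingHom.id F) ϖ !![(0 : F), 1; -1, 0] M}) (hv₀ : v₀.1 = latt (1 : Matrix (Fin 2) (Fin 2) F)) :
    glVertexAct hϖ (gc ^ m) v₀ = glVertexAct hϖ r v₀ := by
  have h0 := hϖ.ne_zero
  have hv0 : valuation F ϖ ≠ 0 := (Valuation.ne_zero_iff _).2 h0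
  have hc0 : c ≠ 0 := fun h => hv0 (by rw [← hc, h, map_zero])
  have hcu : valuation F (c / ϖ) = 1 := by rw [map_div₀, hc, div_self hv0]
  -- `D := diag(1, (c/ϖ)^m) ∈ GL₂(𝒪)` and `↑(gc^m) = ϖ^{-m} · (c/ϖ)^{-m} · (↑r · ↑D)`… we check `latt ↑(gc^m) = ϖ^(-m) • latt ↑r`
  obtain ⟨D, hDval, hDK, -⟩ := exists_mem_glInt_coe_eq_diagonal (F := F) (u := (c / ϖ) ^ m) (by rw [map_pow, hcu, one_pow])
  have hpow : ((gc ^ m : GL (Fin 2) F) : Matrix (Fin 2) (Fin 2) F) = Matrix.diagonal ![c⁻¹ ^ m, 1] := by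
    rw [Units.val_pow_eq_pow_val, hgc, Matrix.diagonal_pow]
    congr 1
    funext i
    fin_cases i <;> simp
  have hmat : ((gc ^ m : GL (Fin 2) F) : Matrix (Fin 2) (Fin 2) F) = (c⁻¹ ^ m) • (((r * D : GL (Fin 2) F)) : Matrix (Fin 2) (Fin 2) F) := by
    rw [hpow, Units.val_mul, hr, hDval, diagonal_mul_diagonal, ← Matrix.diagonal_smul]
    congr 1
    funext i
    fin_cases i
    · simp
    · simp
      field_simp
      rw [← mul_pow, mul_div_cancel₀ c h0]
  -- `c⁻¹^m = ϖ^(-m) · (ϖ/c)^m`, the second factor a unit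
  have hunit : valuation F ((ϖ / c) ^ m) = 1 := by rw [map_pow, map_div₀, hc, div_self hv0, one_pow]
  have hsplit : c⁻¹ ^ m = ϖ ^ (-(m : ℤ)) * (ϖ / c) ^ m := by
    rw [_root_.zpow_neg, zpow_natCast]
    field_simp
    rw [← mul_pow, one_div, inv_mul_eq_div]
  refine glVertexAct_eq_of_mapGL_eq_scaleLattice hϖ _ _ v₀ (j := -(m : ℤ)) ?_
  rw [hv₀, mapGL_latt_one, mapGL_latt_one, hmat, hsplit, ← smul_smul, ← scaleLattice_latt, ← scaleLattice_latt,
    scaleLattice_latt_eq_of_valuation_eq_one hunit, latt_mul_of_mem_glInt _ _ hDK]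

end Literature.NumberTheory.Automorphic.HermitianLatticeTree

namespace Literature.NumberTheory.Automorphic.UnitaryGroup

open Literature.NumberTheory.Automorphic Literature.NumberTheory.Automorphic.HermitianLatticeTree

variable {F : Type*} [Field F] {E : Type*} [Field E] (ι : F →+* E) (σ : E →+* E) {α : E}

/-! ## §1 Norms of torus elements and unitary lifts commuting with `u` -/

/-- **`det t = N(z)`** for the torus element `t = (c′, e′v₀; e′, c′ + e′u₀)` and `z = ι(c′) + ι(e′)·τ_E`, where `τ_E² = ι(u₀) τ_E + ι(v₀)` and `σ(τ_E) = ι(u₀) − τ_E`.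
[cite: LabesseLanglands1979, §2 p. 7] -/
theorem map_mul_self_eq_map_det_of_torus (hσι : ∀ x : F, σ (ι x) = ι x) {u₀ v₀ : F} {τE : E}
    (hτ : τE * τE = ι u₀ * τE + ι v₀) (hστ : σ τE = ι u₀ - τE) {t : GL (Fin 2) F} {c' e' : F}
    (ht : (t : Matrix (Fin 2) (Fin 2) F) = !![c', e' * v₀; e', c' + e' * u₀]) :
    σ (ι c' + ι e' * τE) * (ι c' + ι e' * τE) = ι (t : Matrix (Fin 2) (Fin 2) F).det := by
  rw [ht, det_fin_two_of, map_sub, map_mul, map_mul, map_add, map_mul, map_add, map_mul, map_mul, hσι, hσι, hστ]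
  linear_combination (-(ι e' * ι e')) * hτ

/-- **UNITARY LIFT OF A COMMUTING TORUS ELEMENT.**  If `diag(1,α) u diag(1,α)⁻¹ = s · ι(γ)` and `t ∈ GL₂(F)` commutes with `γ` and has `ι(det t) = σ(z) z` (`z ≠ 0`), then some
`t̃ ∈ U(Φ₂)` has descent `z⁻¹ · ι(t)` and COMMUTES with `u`. [cite: LabesseLanglands1979, §2 p. 8] [cite: Rogawski1990, §3.6 p. 31] -/
theorem exists_comm_lift_of_torus (hσι : ∀ x : F, σ (ι x) = ι x) (hα : σ α = -α) (hα0 : α ≠ 0)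
    {u : ↥(unitaryGroupOfForm σ !![(0 : E), 1; 1, 0])} {s : E} {γ : GL (Fin 2) F}
    (hsu : Matrix.diagonal ![1, α] * ((u : GL (Fin 2) E) : Matrix (Fin 2) (Fin 2) E) * Matrix.diagonal ![1, α⁻¹] = s • (γ : Matrix (Fin 2) (Fin 2) F).map ι)
    {t : GL (Fin 2) F} (hcomm : t * γ = γ * t) {z : E} (hz0 : z ≠ 0) (hz : σ z * z = ι (t : Matrix (Fin 2) (Fin 2) F).det) :
    ∃ tU : ↥(unitaryGroupOfForm σ !![(0 : E), 1; 1, 0]), tU * u = u * tU ∧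
      Matrix.diagonal ![1, α] * ((tU : GL (Fin 2) E) : Matrix (Fin 2) (Fin 2) E) * Matrix.diagonal ![1, α⁻¹] = z⁻¹ • (t : Matrix (Fin 2) (Fin 2) F).map ι := by
  have hσz : σ z ≠ 0 := by rw [map_ne_zero]; exact hz0
  have hnorm : σ z⁻¹ * z⁻¹ * ι (t : Matrix (Fin 2) (Fin 2) F).det = 1 := by
    rw [← hz, map_inv₀]
    field_simp
  obtain ⟨tU, htU⟩ := exists_mem_unitaryGroupOfForm_conj_eq_smul_map ι σ hσι hα hα0 hnorm
  refine ⟨tU, ?_, htU⟩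
  -- conjugation by `diag(1,α)` is injective and multiplicative
  have key : Matrix.diagonal ![1, α] * (((tU * u : ↥(unitaryGroupOfForm σ !![(0 : E), 1; 1, 0])) : GL (Fin 2) E) : Matrix (Fin 2) (Fin 2) E) * Matrix.diagonal ![1, α⁻¹] =
      Matrix.diagonal ![1, α] * (((u * tU : ↥(unitaryGroupOfForm σ !![(0 : E), 1; 1, 0])) : GL (Fin 2) E) : Matrix (Fin 2) (Fin 2) E) * Matrix.diagonal ![1, α⁻¹] := by
    have split : ∀ a b : GL (Fin 2) E, Matrix.diagonal ![1, α] * ((a * b : GL (Fin 2) E) : Matrix (Fin 2) (Fin 2) E) * Matrix.diagonal ![1, α⁻¹] =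
        (Matrix.diagonal ![1, α] * (a : Matrix (Fin 2) (Fin 2) E) * Matrix.diagonal ![1, α⁻¹]) *
          (Matrix.diagonal ![1, α] * (b : Matrix (Fin 2) (Fin 2) E) * Matrix.diagonal ![1, α⁻¹]) := by
      intro a b
      rw [Units.val_mul]
      simp only [Matrix.mul_assoc]
      rw [← Matrix.mul_assoc (Matrix.diagonal ![1, α⁻¹]) (Matrix.diagonal ![1, α]), diagonal_inv_mul_diagonal hα0, Matrix.one_mul]
    rw [Subgroup.coe_mul, Subgroup.coe_mul, split, split, htU, hsu, Matrix.smul_mul, Matrix.mul_smul, Matrix.smul_mul, Matrix.mul_smul, smul_smul, smul_smul,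
      mul_comm s z⁻¹, ← Matrix.map_mul, ← Matrix.map_mul, ← Units.val_mul, ← Units.val_mul, hcomm]
  have hcancel : ∀ X Y : Matrix (Fin 2) (Fin 2) E,
      Matrix.diagonal ![1, α] * X * Matrix.diagonal ![1, α⁻¹] = Matrix.diagonal ![1, α] * Y * Matrix.diagonal ![1, α⁻¹] → X = Y := by
    intro X Y hXY
    have h := congrArg (fun Z => Matrix.diagonal ![1, α⁻¹] * Z * Matrix.diagonal ![1, α]) hXY
    simp only [Matrix.mul_assoc] at h
    rwa [diagonal_inv_mul_diagonal hα0, Matrix.mul_one, Matrix.mul_one, ← Matrix.mul_assoc, ← Matrix.mul_assoc, diagonal_inv_mul_diagonal hα0,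
      Matrix.one_mul, Matrix.one_mul] at h
  exact Subtype.ext (Units.ext (hcancel _ _ key))

/-! ## §2 The shell decomposition lifts to `U(Φ₂)` -/

section Tree

variable [ValuativeRel F] {ϖ : F} (hϖ : IsUniformizingElement ϖ) [IsDiscreteValuationRing 𝒪[F]]
  (hρ : ∀ u : GL (Fin 2) E, u ∈ unitaryGroupOfForm σ !![(0 : E), 1; 1, 0] →
      ∃ (s : E) (g : GL (Fin 2) F), s ≠ 0 ∧ Matrix.diagonal ![1, α] * (u : Matrix (Fin 2) (Fin 2) E) * Matrix.diagonal ![1, α⁻¹] =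
        s • (g : Matrix (Fin 2) (Fin 2) F).map ι)

include hϖ in
/-- **`ρ(t̃ ũ) · M = (t g) · M`** for descent representatives `(z⁻¹, t)` of `t̃` and `(s, g)` of `ũ`. [cite: Serre1980Trees, Ch. II §1.3] -/
theorem rhoVertexAct_mul_eq_glVertexAct_mul {a b : ↥(unitaryGroupOfForm σ !![(0 : E), 1; 1, 0])} {sa sb : E} {ga gb : GL (Fin 2) F}
    (hα0 : α ≠ 0) (hsa : sa ≠ 0) (hsb : sb ≠ 0)
    (ha : Matrix.diagonal ![1, α] * ((a : GL (Fin 2) E) : Matrix (Fin 2) (Fin 2) E) * Matrix.diagonal ![1, α⁻¹] = sa • (ga : Matrix (Fin 2) (Fin 2) F).map ι)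
    (hb : Matrix.diagonal ![1, α] * ((b : GL (Fin 2) E) : Matrix (Fin 2) (Fin 2) E) * Matrix.diagonal ![1, α⁻¹] = sb • (gb : Matrix (Fin 2) (Fin 2) F).map ι)
    (M : {M : Submodule 𝒪[F] (Fin 2 → F) // IsSpecialLattice (RingHom.id F) ϖ !![(0 : F), 1; -1, 0] M}) :
    rhoVertexAct ι σ hϖ hρ (a * b) M = glVertexAct hϖ (ga * gb) M := by
  rw [rhoVertexAct_mul ι σ hϖ hρ hα0, rhoVertexAct_eq_glVertexAct ι σ hϖ hρ b hsb hb, rhoVertexAct_eq_glVertexAct ι σ hϖ hρ a hsa ha, glVertexAct_mul]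

include hϖ in
/-- **THE SHELL DECOMPOSITION ON `U(Φ₂)` (`hshell`).**  Let `u ∈ U` have descent `s · ι(γ)`; let `(τ_E; u₀, v₀)` be a quadratic datum as above; let `r̃ : ℕ → U` be unitary
shell representatives over `r : ℕ → GL₂(F)` (`ρ(r̃ m) · v₀ = r m · v₀`); and suppose the GL₂(F)-level decomposition: every vertex `x` is `(t · r (d x)) · v₀` with `t` of torus
shape commuting with `γ` (A-p17 (g23) ★ `exists_torus_glVertexAct_shellRep_eq` ∕ `exists_torus_comm_glVertexAct_shellRep_eq`).  Then every vertex `x` is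
`ρ(t̃ · r̃ (d x)) · v₀` for some `t̃ ∈ U` COMMUTING WITH `u`. [cite: LabesseLanglands1979, §2 p. 8] [cite: Rogawski1990, §4.9 p. 54] -/
theorem exists_comm_rhoVertexAct_mul_eq (hσι : ∀ x : F, σ (ι x) = ι x) (hα : σ α = -α) (hα0 : α ≠ 0)
    {u₀ v₀ : F} {τE : E} (hτ : τE * τE = ι u₀ * τE + ι v₀) (hστ : σ τE = ι u₀ - τE)
    {u : ↥(unitaryGroupOfForm σ !![(0 : E), 1; 1, 0])} {s : E} {γ : GL (Fin 2) F}
    (hsu : Matrix.diagonal ![1, α] * ((u : GL (Fin 2) E) : Matrix (Fin 2) (Fin 2) E) * Matrix.diagonal ![1, α⁻¹] = s • (γ : Matrix (Fin 2) (Fin 2) F).map ι)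
    (x₀ : {M : Submodule 𝒪[F] (Fin 2 → F) // IsSpecialLattice (RingHom.id F) ϖ !![(0 : F), 1; -1, 0] M})
    {d : {M : Submodule 𝒪[F] (Fin 2 → F) // IsSpecialLattice (RingHom.id F) ϖ !![(0 : F), 1; -1, 0] M} → ℕ}
    {r : ℕ → GL (Fin 2) F} {rU : ℕ → ↥(unitaryGroupOfForm σ !![(0 : E), 1; 1, 0])}
    (hrU : ∀ m, rhoVertexAct ι σ hϖ hρ (rU m) x₀ = glVertexAct hϖ (r m) x₀)
    (hGL : ∀ x : {M : Submodule 𝒪[F] (Fin 2 → F) // IsSpecialLattice (RingHom.id F) ϖ !![(0 : F), 1; -1, 0] M},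
      ∃ (t : GL (Fin 2) F) (c' e' : F), (t : Matrix (Fin 2) (Fin 2) F) = !![c', e' * v₀; e', c' + e' * u₀] ∧ t * γ = γ * t ∧
        glVertexAct hϖ (t * r (d x)) x₀ = x)
    (x : {M : Submodule 𝒪[F] (Fin 2 → F) // IsSpecialLattice (RingHom.id F) ϖ !![(0 : F), 1; -1, 0] M}) :
    ∃ tU : ↥(unitaryGroupOfForm σ !![(0 : E), 1; 1, 0]), tU * u = u * tU ∧ rhoVertexAct ι σ hϖ hρ (tU * rU (d x)) x₀ = x := by
  obtain ⟨t, c', e', ht, hcomm, hx⟩ := hGL x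
  have hz := map_mul_self_eq_map_det_of_torus ι σ hσι hτ hστ ht
  have hdet0 : (t : Matrix (Fin 2) (Fin 2) F).det ≠ 0 := (t.isUnit.map Matrix.detMonoidHom).ne_zero
  have hz0 : ι c' + ι e' * τE ≠ 0 := by
    intro h0
    rw [h0, mul_zero] at hz
    exact hdet0 ((map_eq_zero ι).1 hz.symm)
  obtain ⟨tU, htUcomm, htU⟩ := exists_comm_lift_of_torus ι σ hσι hα hα0 hsu hcomm hz0 hz
  refine ⟨tU, htUcomm, ?_⟩
  rw [rhoVertexAct_mul ι σ hϖ hρ hα0, hrU, rhoVertexAct_eq_glVertexAct ι σ hϖ hρ tU (inv_ne_zero hz0) htU, ← glVertexAct_mul, hx]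

/-! ## §3 The unitary shell representatives `ũ_η⁻¹ ^ m` -/

include hϖ in
/-- **`ρ(ũ_η⁻¹ ^ m) · v₀ = diag(1, ϖ^m) · v₀`** for `ũ_η = diag(η, (ση)⁻¹) ∈ U(Φ₂)` with `ι(c) = η σ(η)`, `|c|_F = |ϖ|_F` (descent `diag(1,α) ũ_η⁻¹ diag(1,α)⁻¹ = σ(η) · ι(diag(c⁻¹, 1))`,
then §0). [cite: LabesseLanglands1979, §2 p. 8] [cite: Serre1980Trees, Ch. II §1.3] -/
theorem rhoVertexAct_inv_pow_root_eq (hα0 : α ≠ 0) {η : E} {uη : ↥(unitaryGroupOfForm σ !![(0 : E), 1; 1, 0])}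
    (huη : ((uη : GL (Fin 2) E) : Matrix (Fin 2) (Fin 2) E) = Matrix.diagonal ![η, (σ η)⁻¹]) {c : F} (hc : ι c = η * σ η)
    (hcv : valuation F c = valuation F ϖ) {r : GL (Fin 2) F} {m : ℕ} (hr : (r : Matrix (Fin 2) (Fin 2) F) = Matrix.diagonal ![1, ϖ ^ m])
    (x₀ : {M : Submodule 𝒪[F] (Fin 2 → F) // IsSpecialLattice (RingHom.id F) ϖ !![(0 : F), 1; -1, 0] M}) (hx₀ : x₀.1 = latt (1 : Matrix (Fin 2) (Fin 2) F)) :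
    rhoVertexAct ι σ hϖ hρ (uη⁻¹ ^ m) x₀ = glVertexAct hϖ r x₀ := by
  have h0 := hϖ.ne_zero
  have hv0 : valuation F ϖ ≠ 0 := (Valuation.ne_zero_iff _).2 h0
  have hc0 : c ≠ 0 := fun h => hv0 (by rw [← hcv, h, map_zero])
  have hη0 : η ≠ 0 := by
    intro h
    rw [h, zero_mul, map_eq_zero] at hc
    exact hc0 hc
  have hση0 : σ η ≠ 0 := by rw [map_ne_zero]; exact hη0
  -- `gc = diag(c⁻¹, 1) ∈ GL₂(F)`
  have hdet : (Matrix.diagonal ![c⁻¹, (1 : F)]).det ≠ 0 := by rw [det_diagonal, Fin.prod_univ_two]; simp [hc0]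
  set gc : GL (Fin 2) F := Matrix.GeneralLinearGroup.mk'' _ (isUnit_iff_ne_zero.2 hdet) with hgcdef
  have hgc : (gc : Matrix (Fin 2) (Fin 2) F) = Matrix.diagonal ![c⁻¹, 1] := rfl
  -- descent of `uη⁻¹`: `diag(1,α) uη⁻¹ diag(1,α)⁻¹ = σ η • ι(gc)`
  have hinv : (((uη⁻¹ : ↥(unitaryGroupOfForm σ !![(0 : E), 1; 1, 0])) : GL (Fin 2) E) : Matrix (Fin 2) (Fin 2) E) = Matrix.diagonal ![η⁻¹, σ η] := by
    have hprod : ((uη : GL (Fin 2) E) : Matrix (Fin 2) (Fin 2) E) * Matrix.diagonal ![η⁻¹, σ η] = 1 := by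
      rw [huη, diagonal_mul_diagonal, ← diagonal_one]
      congr 1; funext i; fin_cases i <;> simp [mul_inv_cancel₀ hη0, inv_mul_cancel₀ hση0]
    rw [Subgroup.coe_inv, Matrix.coe_units_inv]
    exact Matrix.inv_eq_right_inv hprod
  have hdesc : Matrix.diagonal ![1, α] * (((uη⁻¹ : ↥(unitaryGroupOfForm σ !![(0 : E), 1; 1, 0])) : GL (Fin 2) E) : Matrix (Fin 2) (Fin 2) E) * Matrix.diagonal ![1, α⁻¹] =
      σ η • (gc : Matrix (Fin 2) (Fin 2) F).map ι := by
    rw [hinv, hgc, diagonal_mul_diagonal, diagonal_mul_diagonal, Matrix.diagonal_map (map_zero _), ← Matrix.diagonal_smul]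
    congr 1; funext i; fin_cases i <;> simp [hc] <;> field_simp
  -- descent of the power
  have hpow : ∀ (n : ℕ) (M : {M : Submodule 𝒪[F] (Fin 2 → F) // IsSpecialLattice (RingHom.id F) ϖ !![(0 : F), 1; -1, 0] M}),
      rhoVertexAct ι σ hϖ hρ (uη⁻¹ ^ n) M = glVertexAct hϖ (gc ^ n) M := by
    intro n
    induction n with
    | zero => intro M; rw [pow_zero, pow_zero, rhoVertexAct_one ι σ hϖ hρ hα0, glVertexAct_one]
    | succ n ih => intro M; rw [pow_succ, pow_succ, rhoVertexAct_mul ι σ hϖ hρ hα0, glVertexAct_mul, rhoVertexAct_eq_glVertexAct ι σ hϖ hρ _ hση0 hdesc, ih]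
  rw [hpow m x₀]
  exact glVertexAct_diagonal_inv_pow_root_eq hϖ hcv hgc hr x₀ hx₀

end Tree

end Literature.NumberTheory.Automorphic.UnitaryGroup

end
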